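import Summits.CriticalPhenomena.PercolationContinuityZ3.Theorems.PercNearOneGluingNoHeavyPcintWinKernelChain
import HarnessLib

/-!
# PCINT lane, kernel window certificates for kind `nawchain_cw` (B2c) — integer weights, rows, the bound theorem

Cell `prim-pcint`, seat `prim-pcint-2` (gen 3); memo `run/shared/lean/prim/pcint/REDUCTIONS.md` §B2c, INTERVAL-PLAN §16.
Does NOT build on p205010.  The integer weight `termSc` of the B2c window automaton (`weightSc_mul_den`: it is EXACTLY the
real transition weight `p q̄^u coinFactor q̄ c` times the common denominator `denSc`), the scaled Collatz–Wielandt rows keyed by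
the Gram code (`rowScK`, `rowOKScK`, `nfOKSc`) and read from a search tree (`rowOKScT`), the bound theorem
**`le_siteCriticalProb_of_checkScK`** (`pn/10^4 ≤ p_c^site(ℤ^d)` from the row check on first-use normal forms and elementary
integer side conditions), and the adapters `allRange_nfOKSc_of_nfCodes`, `all_rowOKScK_of_tree` used by the instances.
-/

namespace Summit.CriticalPhenomena.PercolationContinuityZ3.Theorems.Pcint

open Finset Literature.Probability.Percolation Literature.Probability.LatticeModels

namespace WinK

variable {d m : ℕ}

/-! ### Integer weights -/

/-- Scaled coin factor `2·10^{4 cmax} · coinFactor (Q/10^4) c` (exact for `c ≤ cmax`). [folklore] -/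
def cfN (Q cmax c : ℕ) : ℕ := if c = 0 then 2 * 10 ^ (4 * cmax) else 10 ^ (4 * cmax) + Q ^ c * 10 ^ (4 * (cmax - c))

/-- Scaled B2c transition weight `DEN · p q̄^u coinFactor q̄ c`, `DEN = 2·10^(4 + 4 umax + 4 cmax)` (exact for `u ≤ umax`,
`c ≤ cmax`). [folklore] -/
def termSc (pn Q umax cmax u c : ℕ) : ℕ := pn * Q ^ u * cfN Q cmax c * 10 ^ (4 * (umax - u))

/-- The scaled coin factor is exact. [folklore] -/
theorem coinFactor_mul_den {Q cmax c : ℕ} (hc : c ≤ cmax) :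
    coinFactor ((Q : ℝ) / 10 ^ 4) c * (2 * 10 ^ (4 * cmax)) = (cfN Q cmax c : ℝ) := by
  obtain ⟨i, rfl⟩ := Nat.exists_eq_add_of_le hc
  rw [cfN, Nat.add_sub_cancel_left, coinFactor]
  have hq : ∀ n : ℕ, ((10 : ℝ) ^ 4) ^ n = ((10 : ℝ) ^ n) ^ 4 := fun n => by rw [← pow_mul, ← pow_mul, mul_comm]
  by_cases h0 : c = 0
  · subst h0
    simp only [if_true]
    push_cast; ring
  · rw [if_neg h0, if_neg h0]
    push_cast
    rw [div_pow, hq c]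
    have hTc : ((10 : ℝ) ^ c) ^ 4 ≠ 0 := by positivity
    field_simp
    ring

/-- **The B2c integer weight is exact.** [folklore] -/
theorem weightSc_mul_den {pn Q umax cmax u c : ℕ} (hu : u ≤ umax) (hc : c ≤ cmax) :
    ((pn : ℝ) / 10 ^ 4) * (((Q : ℝ) / 10 ^ 4) ^ u * coinFactor ((Q : ℝ) / 10 ^ 4) c) *
      (2 * 10 ^ (4 + 4 * umax + 4 * cmax)) = (termSc pn Q umax cmax u c : ℝ) := by
  obtain ⟨j, rfl⟩ := Nat.exists_eq_add_of_le hu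
  rw [termSc, Nat.add_sub_cancel_left]
  have hcf := coinFactor_mul_den (Q := Q) hc
  simp only [Nat.cast_mul, Nat.cast_pow, Nat.cast_ofNat]
  rw [← hcf]
  have e : (10 : ℝ) ^ (4 + 4 * (u + j) + 4 * cmax) = 10 ^ 4 * (10 ^ 4) ^ u * 10 ^ (4 * j) * 10 ^ (4 * cmax) := by
    rw [← pow_mul]
    repeat rw [← pow_add]
    congr 1; ring
  rw [e, div_pow]
  have hT : (10 : ℝ) ^ 4 ≠ 0 := by positivity
  have hTu : ((10 : ℝ) ^ 4) ^ u ≠ 0 := by positivity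
  field_simp

/-! ### Rows keyed by the Gram code, checks on normal forms, tree form -/

section Rows

variable (d m kc pn Q lamN : ℕ) (tbl : List (ℕ × ℕ)) (dflt : ℕ) (t : KT)

/-- B2c denominator `2·10^(4 + 16 d + 8)` (`umax = 4d`, `cmax = 2`). [folklore] -/
def denSc : ℕ := 2 * 10 ^ (4 + 4 * (4 * d) + 4 * 2)

/-- One summand of the scaled B2c row (keyed values), on the one-pass site list. [folklore] -/
def rowTermScK (u : Fin (m + 1) → Fin d × Bool) (a : Fin d × Bool) : ℕ :=
  let ps := sitesF u a
  if okNF m ps then termSc pn Q (4 * d) 2 (uNF d m kc ps) (ceNF d m kc ps a) * vK d m tbl dflt (wshift u a) else 0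

/-- The B2c summand in terms of the reference tests. [folklore] -/
theorem rowTermScK_eq (u : Fin (m + 1) → Fin d × Bool) (a : Fin d × Bool) :
    rowTermScK d m kc pn Q tbl dflt u a =
      if okN u a then termSc pn Q (4 * d) 2 (uN kc u a) (ceN kc u a) * vK d m tbl dflt (wshift u a) else 0 := by
  simp only [rowTermScK, sitesF_eq_sites, okNF_eq, uN, ceN]

/-- Scaled B2c row (keyed values). [folklore] -/
def rowScK (u : Fin (m + 1) → Fin d × Bool) : ℕ := ∑ a : Fin d × Bool, rowTermScK d m kc pn Q tbl dflt u a

/-- B2c row check on one code. [folklore] -/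
def rowOKScK [NeZero d] (c : ℕ) : Bool :=
  decide (10 ^ 5 * rowScK d m kc pn Q tbl dflt (decodeW d (m + 1) c) ≤ lamN * denSc d * vK d m tbl dflt (decodeW d (m + 1) c))

/-- B2c check on one code, required only in first-use normal form. [folklore] -/
def nfOKSc [NeZero d] (c : ℕ) : Bool := !(isNF (decodeW d (m + 1) c)) || rowOKScK d m kc pn Q lamN tbl dflt c

/-- One summand of the scaled B2c row, values from a search tree. [folklore] -/
def rowTermScT (u : Fin (m + 1) → Fin d × Bool) (a : Fin d × Bool) : ℕ :=
  let ps := sitesF u a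
  if okNF m ps then termSc pn Q (4 * d) 2 (uNF d m kc ps) (ceNF d m kc ps a) * vKT d m t dflt (wshift u a) else 0

/-- Scaled B2c row, values from the tree. [folklore] -/
def rowScT (u : Fin (m + 1) → Fin d × Bool) : ℕ := ∑ a : Fin d × Bool, rowTermScT d m kc pn Q dflt t u a

/-- B2c row check on one code, values from the tree. [folklore] -/
def rowOKScT [NeZero d] (c : ℕ) : Bool :=
  decide (10 ^ 5 * rowScT d m kc pn Q dflt t (decodeW d (m + 1) c) ≤ lamN * denSc d * vKT d m t dflt (decodeW d (m + 1) c))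

variable {d m kc pn Q lamN tbl dflt t}

/-- The B2c summand is invariant. [folklore] -/
theorem rowTermScK_actW (g : SPerm d) (u : Fin (m + 1) → Fin d × Bool) (a : Fin d × Bool) :
    rowTermScK d m kc pn Q tbl dflt (actW g u) (actStep g a) = rowTermScK d m kc pn Q tbl dflt u a := by
  rw [rowTermScK_eq, rowTermScK_eq, okN_actW, uN_actW, ceN_actW, wshift_actW, vK_actW]

/-- **The B2c row is orbit-constant.** [folklore] -/
theorem rowScK_actW (g : SPerm d) (u : Fin (m + 1) → Fin d × Bool) :
    rowScK d m kc pn Q tbl dflt (actW g u) = rowScK d m kc pn Q tbl dflt u := by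
  unfold rowScK
  rw [← Fintype.sum_equiv (actStepEquiv g) (fun a => rowTermScK d m kc pn Q tbl dflt (actW g u) (actStep g a))
    (fun b => rowTermScK d m kc pn Q tbl dflt (actW g u) b) (fun _ => rfl)]
  exact Fintype.sum_congr _ _ fun a => rowTermScK_actW g u a

/-- **Tree rows are table rows (B2c).** [folklore] -/
theorem rowOKScT_eq [NeZero d] (ho : t.ordered = true) (ht : t.toList = tbl) :
    rowOKScT d m kc pn Q lamN dflt t = rowOKScK d m kc pn Q lamN tbl dflt := by
  funext c
  have hv : ∀ u : Fin (m + 1) → Fin d × Bool, vKT d m t dflt u = vK d m tbl dflt u :=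
    fun u => lookupT_eq_lookupK ho ht dflt u
  simp only [rowOKScT, rowOKScK, rowScT, rowScK, rowTermScT, rowTermScK, hv]

/-- A B2c row check on a list of codes, done on an ordered tree listing the table, is the table check. [folklore] -/
theorem all_rowOKScK_of_tree [NeZero d] (ho : t.ordered = true) (ht : t.toList = tbl) {l : List ℕ}
    (h : l.all (rowOKScT d m kc pn Q lamN dflt t) = true) : l.all (rowOKScK d m kc pn Q lamN tbl dflt) = true := by
  rw [← rowOKScT_eq ho ht]; exact h

/-- The rows on the enumerated normal forms give the range check of `le_siteCriticalProb_of_checkScK`. [folklore] -/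
theorem allRange_nfOKSc_of_nfCodes [NeZero d] {N : ℕ}
    (h : (nfCodes d (m + 1)).all (rowOKScK d m kc pn Q lamN tbl dflt) = true) :
    allRange (nfOKSc d m kc pn Q lamN tbl dflt) 0 N = true := by
  rw [allRange, List.all_eq_true]
  intro c _
  rw [nfOKSc]
  rcases Bool.eq_false_or_eq_true (isNF (decodeW d (m + 1) c)) with hnf | hnf
  · rw [hnf, Bool.not_true, Bool.false_or]
    have h1 := List.all_eq_true.1 h _ (encW_mem_nfCodes hnf)
    rw [rowOKScK, decodeW_encW] at h1
    rw [rowOKScK]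
    exact h1
  · rw [hnf, Bool.not_false, Bool.true_or]

end Rows

/-! ### The generic bound theorem -/

/-- **Kernel B2c certificate on normal forms ⇒ `pn/10^4 ≤ p_c^site(ℤ^d)`.**  Integer side conditions: `pn ≤ 10^4`,
`Q ≤ 10^4`, `Q^{2d} ≥ (10^4 - pn)·10^{4(2d-1)}` (`q̄^{2d} ≥ 1-p`); `0 < lamN < 10^5`; table values in `[vlo, vhi]`,
`vlo > 0`; and the row check on the codes of windows in first-use normal form. [folklore] -/
theorem le_siteCriticalProb_of_checkScK {d m kc pn Q lamN : ℕ} [NeZero d] {tbl : List (ℕ × ℕ)} {dflt vlo vhi : ℕ}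
    (hpn : pn ≤ 10 ^ 4) (hQ1 : Q ≤ 10 ^ 4) (hQ : (10 ^ 4 - pn) * 10 ^ (4 * (2 * d - 1)) ≤ Q ^ (2 * d))
    (hlam0 : 0 < lamN) (hlam : lamN < 10 ^ 5)
    (htbl : ∀ e ∈ tbl, vlo ≤ e.2 ∧ e.2 ≤ vhi) (hdflt : vlo ≤ dflt ∧ dflt ≤ vhi) (hvlo : 0 < vlo)
    (hcheck : allRange (nfOKSc d m kc pn Q lamN tbl dflt) 0 ((2 * d) ^ (m + 1)) = true) :
    (pn : ℝ) / 10 ^ 4 ≤ siteCriticalProb (zdGraph d) 0 := by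
  have hd : 0 < d := NeZero.pos d
  have hp0 : (0 : ℝ) ≤ (pn : ℝ) / 10 ^ 4 := by positivity
  have hp1 : (pn : ℝ) / 10 ^ 4 ≤ 1 := by
    rw [div_le_one (by positivity)]; exact_mod_cast hpn
  set p : unitInterval := ⟨(pn : ℝ) / 10 ^ 4, hp0, hp1⟩ with hpdef
  have hpc : (p : ℝ) = (pn : ℝ) / 10 ^ 4 := rfl
  have hq0 : (0 : ℝ) ≤ (Q : ℝ) / 10 ^ 4 := by positivity
  have hqb1 : (Q : ℝ) / 10 ^ 4 ≤ 1 := by rw [div_le_one (by positivity)]; exact_mod_cast hQ1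
  have hpq : 1 - (p : ℝ) ≤ ((Q : ℝ) / 10 ^ 4) ^ (2 * d) := by
    have hQr : ((10 ^ 4 - pn : ℕ) : ℝ) * 10 ^ (4 * (2 * d - 1)) ≤ (Q : ℝ) ^ (2 * d) := by exact_mod_cast hQ
    rw [Nat.cast_sub hpn] at hQr
    simp only [Nat.cast_pow, Nat.cast_ofNat] at hQr
    obtain ⟨d', hd'⟩ : ∃ d', 2 * d = d' + 1 := ⟨2 * d - 1, by omega⟩
    have hsub : 2 * d - 1 = d' := by omega
    rw [hsub, hd'] at hQr
    rw [hpc, hd', div_pow, ← pow_mul, le_div_iff₀ (by positivity)]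
    have : (1 - (pn : ℝ) / 10 ^ 4) * 10 ^ (4 * (d' + 1)) = (10 ^ 4 - (pn : ℝ)) * 10 ^ (4 * d') := by ring
    rw [this]
    exact hQr
  have hvlo' : (0 : ℝ) < vlo := by exact_mod_cast hvlo
  have hlamr : (0 : ℝ) < lamN := by exact_mod_cast hlam0
  have hlam0' : (0 : ℝ) < (lamN : ℝ) / 10 ^ 5 := by positivity
  have hlam1' : (lamN : ℝ) / 10 ^ 5 < 1 := by rw [div_lt_one (by positivity)]; exact_mod_cast hlam
  have hrowN : ∀ u : Fin (m + 1) → Fin d × Bool,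
      10 ^ 5 * rowScK d m kc pn Q tbl dflt u ≤ lamN * denSc d * vK d m tbl dflt u := by
    intro u
    obtain ⟨g, hg⟩ := exists_isNF_actW u
    have h1 := forall_of_allRange hcheck (actW g u)
    rw [nfOKSc, decodeW_encW, hg, Bool.not_true, Bool.false_or, rowOKScK, decodeW_encW, decide_eq_true_eq,
      rowScK_actW, vK_actW] at h1
    exact h1
  rw [← hpc]
  refine le_siteCriticalProb_zd_of_nawChainWindowCert (m := m) ((⟨0, hd⟩ : Fin d), true) kc okN (uN kc) (ceN kc) hokN
    (fun u a _ _ => (uN_eq kc u a).le) (fun u a _ _ => (ceN_eq kc u a).le) p (q := (Q : ℝ) / 10 ^ 4)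
    (qb := (Q : ℝ) / 10 ^ 4) hq0 le_rfl hqb1 hpq
    (fun u => (vK d m tbl dflt u : ℝ)) (vmin := vlo) (vmax := vhi) (lam := (lamN : ℝ) / 10 ^ 5) hvlo'
    (fun u => by exact_mod_cast (lookupK_bounds htbl hdflt u).1)
    (fun u => by exact_mod_cast (lookupK_bounds htbl hdflt u).2) hlam0' hlam1' fun u => ?_
  have hden : (0 : ℝ) < (denSc d : ℝ) := by unfold denSc; positivity
  have hN : ((10 ^ 5 * rowScK d m kc pn Q tbl dflt u : ℕ) : ℝ) ≤ ((lamN * denSc d * vK d m tbl dflt u : ℕ) : ℝ) := by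
    exact_mod_cast hrowN u
  push_cast at hN
  have hrow : (∑ a : Fin d × Bool, if okN u a then
      (p : ℝ) * (((Q : ℝ) / 10 ^ 4) ^ uN kc u a * coinFactor ((Q : ℝ) / 10 ^ 4) (ceN kc u a)) *
        (vK d m tbl dflt (wshift u a) : ℝ) else 0) * (denSc d : ℝ) ≤ (rowScK d m kc pn Q tbl dflt u : ℝ) := by
    rw [rowScK, Nat.cast_sum, Finset.sum_mul]
    refine Finset.sum_le_sum fun a _ => le_of_eq ?_
    rw [rowTermScK_eq]
    by_cases h : okN u a = true
    · simp only [h, if_true]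
      rw [hpc, Nat.cast_mul, ← weightSc_mul_den (uN_le kc u a) (ceN_le_two kc u a), denSc]
      push_cast; ring
    · simp [h]
  rw [← le_div_iff₀ hden] at hrow
  refine hrow.trans ?_
  rw [div_le_iff₀ hden]
  linarith [hN]

end WinK

end Summit.CriticalPhenomena.PercolationContinuityZ3.Theorems.Pcint
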